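import Literature.Probability.LatticeModels.GaussianPairingBoundCouplings
import Literature.Probability.LatticeModels.PairIsing
import Literature.Probability.LatticeModels.CriticalWickIff
import HarnessLib

/-!
# Transport of pair correlations along an affine coupling family (fluctuation formula, Lebowitz bound, FTC)

Topic `Literature/Probability/LatticeModels`; PROOFS-ONLY leaf file (theorems only, no definition, no named fact) over the
light pair-coupling Ising module `PairIsing.gibbsAvg` (`PairIsing.lean`). For a one-parameter family of coupling matrices
`t ↦ c₀ + t·c₁` on a finite set `ι`:

* `PairIsing.hasDerivAt_gibbsAvg_affine` — the fluctuation formula `d/dt ⟨f⟩ = ⟨f H₁⟩ - ⟨f⟩⟨H₁⟩`,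
  `H₁(σ) = ∑_a ∑_b c₁(a,b) σ_aσ_b` (finite sums of exponentials, quotient rule; Glimm–Jaffe 1987 Prop. 4.2.1 pattern),
  with `PairIsing.continuous_gibbsAvg_affine`, `PairIsing.continuous_gibbsAvg_of_affine`;
* `PairIsing.cov_pair_pair_le` — Lebowitz' `u₄ ≤ 0` in Newman's Gaussian form
  `Cov(σ_xσ_y; σ_aσ_b) ≤ ⟨σ_xσ_a⟩⟨σ_yσ_b⟩ + ⟨σ_xσ_b⟩⟨σ_yσ_a⟩` for `c ≥ 0` (from the tree's
  `PairIsing.avg_spinMonomial_le_pairingSum` at order four and `pairingSum_two`);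
* `PairIsing.cov_energy_le` — `Cov(σ_xσ_y; H₁) ≤ R·(B(x) + B(y))`, `B(x) = ∑_a χ_a ⟨σ_xσ_a⟩²`, when `c₁ ≥ 0` has row and
  column sums `≤ R·χ` (termwise Lebowitz bound, `ab ≤ (a²+b²)/2`, resummation) — "the derivatives are bounded from above
  by sums of products of two-point functions" (Glimm–Jaffe 1987 §17.5);
* `PairIsing.transport_affine` — the integrated form (FTC, `intervalIntegral.integral_eq_sub_of_hasDerivAt`):
  `⟨σ_xσ_y⟩_{J₂} - ⟨σ_xσ_y⟩_{J₁} ≤ 2R ∫_{J₁}^{J₂} B` whenever the bubbles at `x`, `y` are dominated by `B` on `[J₁, J₂] ⊂ [0,∞)`;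
* `endpoint_disorder_of_transport` — the model-free ENDPOINT ARGUMENT: for box quantities `G c L J ≤ 1`, continuous in `J`,
  whose increments below `J` are transported by `K ∫ B` (`B ≥ 0` locally integrable), a disordered left ray `[0, J)`
  (no uniform positive lower bound of `sup_L G c L J'` over `{c | Pl c}`) forces disorder AT `J` (`sup_L`, left-continuity
  of each `G c L`, continuity of the primitive of `B`).

Wanted by route `CriticalPhenomena/Ising3DConformalLimit/ReflectionTwin`, crux `TwinThreshold` (stmt-CriticalPhenomena-16906),
line `seam_renewal`, stub (C′) "integrable sub-threshold bubble ⟹ no plane order at the onset".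

## References

* J. L. Lebowitz, *GHS and other inequalities*, Comm. Math. Phys. 35 (1974) 87–92, eq. (2.5b). [Lebowitz1974]
* C. M. Newman, *Gaussian correlation inequalities for ferromagnets*, Z. Wahrsch. verw. Gebiete 33 (1975) 75–93,
  Theorem 3. [Newman1975Gaussian]
* J. Glimm, A. Jaffe, *Quantum Physics* (2nd ed., Springer 1987), Prop. 4.2.1, Cor. 4.3.3, §17.5. [GlimmJaffe1987]
* S. Friedli, Y. Velenik, *Statistical Mechanics of Lattice Systems* (CUP 2017), §3.8.1. [FriedliVelenik2017]

## Design / not here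

Everything is a finite sum of exponentials plus one-variable calculus; no measure on configurations. The coupling family
is taken either literally as `fun a b => c₀ a b + t * c₁ a b` or as an abstract `cpl : ℝ → ι → ι → ℝ` with the pointwise
identity `cpl t a b = c₀ a b + t * c₁ a b` (so that users need not rewrite under binders). Not here: any lattice geometry
(row/column sums of `c₁` are hypotheses), GKS monotonicity, infinite volume.
-/

noncomputable section

open MeasureTheory Filter Topology Finset

namespace Literature.Probability.LatticeModels

namespace PairIsing

section Affine

variable {ι : Type*} [Fintype ι] [DecidableEq ι]

omit [DecidableEq ι] in
/-- Along `t ↦ c₀ + t·c₁` the Boltzmann weight is `exp(H₀ + t H₁)`. [folklore] -/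
theorem gibbsWeight_affine (c₀ c₁ : ι → ι → ℝ) (t : ℝ) (ρ : SpinConfig ι) :
    PairIsing.gibbsWeight (fun a b => c₀ a b + t * c₁ a b) ρ =
      Real.exp ((∑ a, ∑ b, c₀ a b * (spinAt a ρ * spinAt b ρ)) + t * ∑ a, ∑ b, c₁ a b * (spinAt a ρ * spinAt b ρ)) := by
  unfold PairIsing.gibbsWeight
  congr 1
  simp only [add_mul, Finset.sum_add_distrib, Finset.mul_sum, mul_assoc]

omit [DecidableEq ι] in
/-- `d/dt w_{c₀+tc₁}(σ) = H₁(σ) w_{c₀+tc₁}(σ)`. [folklore] -/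
theorem hasDerivAt_gibbsWeight_affine (c₀ c₁ : ι → ι → ℝ) (ρ : SpinConfig ι) (t : ℝ) :
    HasDerivAt (fun t => PairIsing.gibbsWeight (fun a b => c₀ a b + t * c₁ a b) ρ)
      ((∑ a, ∑ b, c₁ a b * (spinAt a ρ * spinAt b ρ)) * PairIsing.gibbsWeight (fun a b => c₀ a b + t * c₁ a b) ρ) t := by
  simp only [gibbsWeight_affine]
  have h1 : HasDerivAt (fun t : ℝ => (∑ a, ∑ b, c₀ a b * (spinAt a ρ * spinAt b ρ)) +
      t * ∑ a, ∑ b, c₁ a b * (spinAt a ρ * spinAt b ρ)) (∑ a, ∑ b, c₁ a b * (spinAt a ρ * spinAt b ρ)) t := by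
    simpa using ((hasDerivAt_id t).mul_const (∑ a, ∑ b, c₁ a b * (spinAt a ρ * spinAt b ρ))).const_add
      (∑ a, ∑ b, c₀ a b * (spinAt a ρ * spinAt b ρ))
  exact h1.exp.congr_deriv (by ring)

/-- Derivative of a weighted configuration sum along the affine family. [folklore] -/
theorem hasDerivAt_sum_mul_gibbsWeight_affine (c₀ c₁ : ι → ι → ℝ) (f : SpinConfig ι → ℝ) (t : ℝ) :
    HasDerivAt (fun t => ∑ ρ, f ρ * PairIsing.gibbsWeight (fun a b => c₀ a b + t * c₁ a b) ρ)
      (∑ ρ, f ρ * (∑ a, ∑ b, c₁ a b * (spinAt a ρ * spinAt b ρ)) *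
        PairIsing.gibbsWeight (fun a b => c₀ a b + t * c₁ a b) ρ) t := by
  have h := HasDerivAt.fun_sum (u := (univ : Finset (SpinConfig ι))) (x := t)
    (A := fun ρ t => f ρ * PairIsing.gibbsWeight (fun a b => c₀ a b + t * c₁ a b) ρ)
    (A' := fun ρ => f ρ * ((∑ a, ∑ b, c₁ a b * (spinAt a ρ * spinAt b ρ)) *
      PairIsing.gibbsWeight (fun a b => c₀ a b + t * c₁ a b) ρ))
    (fun ρ _ => (hasDerivAt_gibbsWeight_affine c₀ c₁ ρ t).const_mul (f ρ))
  exact h.congr_deriv (Finset.sum_congr rfl fun ρ _ => by ring)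

/-- **Fluctuation formula along an affine coupling family**: with `H₁(σ) = ∑_a ∑_b c₁(a,b) σ_aσ_b`,
`d/dt ⟨f⟩_{c₀+tc₁} = ⟨f H₁⟩ - ⟨f⟩⟨H₁⟩` (finite sums of exponentials, quotient rule). [folklore] -/
theorem hasDerivAt_gibbsAvg_affine (c₀ c₁ : ι → ι → ℝ) (f : SpinConfig ι → ℝ) (t : ℝ) :
    HasDerivAt (fun t => PairIsing.gibbsAvg (fun a b => c₀ a b + t * c₁ a b) f)
      (PairIsing.gibbsAvg (fun a b => c₀ a b + t * c₁ a b)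
          (fun ρ => f ρ * ∑ a, ∑ b, c₁ a b * (spinAt a ρ * spinAt b ρ)) -
        PairIsing.gibbsAvg (fun a b => c₀ a b + t * c₁ a b) f *
          PairIsing.gibbsAvg (fun a b => c₀ a b + t * c₁ a b)
            (fun ρ => ∑ a, ∑ b, c₁ a b * (spinAt a ρ * spinAt b ρ))) t := by
  have hN := hasDerivAt_sum_mul_gibbsWeight_affine c₀ c₁ f t
  have hD := hasDerivAt_sum_mul_gibbsWeight_affine c₀ c₁ (fun _ => 1) t
  simp only [one_mul] at hD
  have hD0 : (∑ ρ, PairIsing.gibbsWeight (fun a b => c₀ a b + t * c₁ a b) ρ) ≠ 0 :=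
    (PairIsing.sum_gibbsWeight_pos _).ne'
  have h := hN.div hD hD0
  change HasDerivAt (fun t => (∑ ρ, f ρ * PairIsing.gibbsWeight (fun a b => c₀ a b + t * c₁ a b) ρ) /
      ∑ ρ, PairIsing.gibbsWeight (fun a b => c₀ a b + t * c₁ a b) ρ) _ t
  refine h.congr_deriv ?_
  simp only [PairIsing.gibbsAvg]
  field_simp

/-- Gibbs averages are continuous along the affine family. [folklore] -/
theorem continuous_gibbsAvg_affine (c₀ c₁ : ι → ι → ℝ) (f : SpinConfig ι → ℝ) :
    Continuous fun t : ℝ => PairIsing.gibbsAvg (fun a b => c₀ a b + t * c₁ a b) f :=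
  (PairIsing.continuous_gibbsAvg f).comp
    (continuous_pi fun _ => continuous_pi fun _ => continuous_const.add (continuous_id.mul continuous_const))

/-- **Lebowitz / Newman**: `Cov(σ_xσ_y; σ_aσ_b) ≤ ⟨σ_xσ_a⟩⟨σ_yσ_b⟩ + ⟨σ_xσ_b⟩⟨σ_yσ_a⟩` for couplings `c ≥ 0` — Newman's
Gaussian inequality `⟨σ_xσ_yσ_aσ_b⟩ ≤ 𝒢₂[⟨σσ⟩]` at order four (`PairIsing.avg_spinMonomial_le_pairingSum`, `pairingSum_two`),
i.e. Lebowitz' `u₄ ≤ 0` (Lebowitz 1974, eq. (2.5b)). [cite: Newman1975Gaussian, Theorem 3, eqs. (3.6)-(3.7)] -/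
theorem cov_pair_pair_le {c : ι → ι → ℝ} (hc : ∀ a b, 0 ≤ c a b) (x y a b : ι) :
    PairIsing.gibbsAvg c (fun s => spinAt x s * spinAt y s * (spinAt a s * spinAt b s)) -
        PairIsing.gibbsAvg c (fun s => spinAt x s * spinAt y s) *
          PairIsing.gibbsAvg c (fun s => spinAt a s * spinAt b s) ≤
      PairIsing.gibbsAvg c (fun s => spinAt x s * spinAt a s) *
          PairIsing.gibbsAvg c (fun s => spinAt y s * spinAt b s) +
        PairIsing.gibbsAvg c (fun s => spinAt x s * spinAt b s) *
          PairIsing.gibbsAvg c (fun s => spinAt y s * spinAt a s) := by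
  have hsymm : ∀ p q : ι, PairIsing.avg c (spinPair p q) = PairIsing.avg c (spinPair q p) := by
    intro p q
    unfold spinPair
    exact congrArg _ (funext fun s => mul_comm _ _)
  have h := PairIsing.avg_spinMonomial_le_pairingSum c (fun a b _ => hc a b) 2 ![x, y, a, b]
  rw [pairingSum_two _ hsymm] at h
  have hm : spinMonomial ![x, y, a, b] = fun s => spinAt x s * spinAt y s * (spinAt a s * spinAt b s) := by
    funext s
    simp only [spinMonomial, Fin.prod_univ_four]
    simp
    ring
  rw [hm] at h
  simp only [Matrix.cons_val] at h
  unfold spinPair at h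
  change PairIsing.gibbsAvg c _ ≤ PairIsing.gibbsAvg c _ * PairIsing.gibbsAvg c _ +
    PairIsing.gibbsAvg c _ * PairIsing.gibbsAvg c _ + PairIsing.gibbsAvg c _ * PairIsing.gibbsAvg c _ at h
  linarith

/-- **Transport bound on the derivative**: for couplings `c ≥ 0` and bond weights `c₁ ≥ 0` with row and column sums
`≤ R·χ`, `Cov_c(σ_xσ_y; H₁) ≤ R·(∑_a χ_a⟨σ_xσ_a⟩² + ∑_a χ_a⟨σ_yσ_a⟩²)` (termwise Lebowitz bound, `ab ≤ (a²+b²)/2`,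
resummation over rows and columns). [folklore] -/
theorem cov_energy_le {c c₁ : ι → ι → ℝ} (hc : ∀ a b, 0 ≤ c a b) (hc₁ : ∀ a b, 0 ≤ c₁ a b)
    (χ : ι → ℝ) (R : ℝ) (hrow : ∀ a, ∑ b, c₁ a b ≤ R * χ a) (hcol : ∀ b, ∑ a, c₁ a b ≤ R * χ b) (x y : ι) :
    PairIsing.gibbsAvg c (fun s => spinAt x s * spinAt y s * ∑ a, ∑ b, c₁ a b * (spinAt a s * spinAt b s)) -
        PairIsing.gibbsAvg c (fun s => spinAt x s * spinAt y s) *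
          PairIsing.gibbsAvg c (fun s => ∑ a, ∑ b, c₁ a b * (spinAt a s * spinAt b s)) ≤
      R * ((∑ a, χ a * PairIsing.gibbsAvg c (fun s => spinAt x s * spinAt a s) ^ 2) +
        ∑ a, χ a * PairIsing.gibbsAvg c (fun s => spinAt y s * spinAt a s) ^ 2) := by
  set S : ι → ι → ℝ := fun p q => PairIsing.gibbsAvg c (fun s => spinAt p s * spinAt q s) with hS
  set Q : ι → ι → ℝ := fun a b =>
    PairIsing.gibbsAvg c (fun s => spinAt x s * spinAt y s * (spinAt a s * spinAt b s)) with hQ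
  -- linearity of the average
  have h1 : PairIsing.gibbsAvg c (fun s => spinAt x s * spinAt y s * ∑ a, ∑ b, c₁ a b * (spinAt a s * spinAt b s)) =
      ∑ a, ∑ b, c₁ a b * Q a b := by
    have hfun : (fun s => spinAt x s * spinAt y s * ∑ a, ∑ b, c₁ a b * (spinAt a s * spinAt b s)) =
        fun s => ∑ a, ∑ b, c₁ a b * (spinAt x s * spinAt y s * (spinAt a s * spinAt b s)) := by
      funext s
      simp only [Finset.mul_sum]
      exact Finset.sum_congr rfl fun a _ => Finset.sum_congr rfl fun b _ => by ring
    rw [hfun, PairIsing.gibbsAvg_finset_sum]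
    refine Finset.sum_congr rfl fun a _ => ?_
    rw [PairIsing.gibbsAvg_finset_sum]
    exact Finset.sum_congr rfl fun b _ => PairIsing.gibbsAvg_const_mul c _ _
  have h2 : PairIsing.gibbsAvg c (fun s => ∑ a, ∑ b, c₁ a b * (spinAt a s * spinAt b s)) = ∑ a, ∑ b, c₁ a b * S a b := by
    rw [PairIsing.gibbsAvg_finset_sum]
    refine Finset.sum_congr rfl fun a _ => ?_
    rw [PairIsing.gibbsAvg_finset_sum]
    exact Finset.sum_congr rfl fun b _ => PairIsing.gibbsAvg_const_mul c _ _
  have hL : PairIsing.gibbsAvg c (fun s => spinAt x s * spinAt y s * ∑ a, ∑ b, c₁ a b * (spinAt a s * spinAt b s)) -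
      PairIsing.gibbsAvg c (fun s => spinAt x s * spinAt y s) *
        PairIsing.gibbsAvg c (fun s => ∑ a, ∑ b, c₁ a b * (spinAt a s * spinAt b s)) =
      ∑ a, ∑ b, c₁ a b * (Q a b - S x y * S a b) := by
    rw [h1, h2, Finset.mul_sum, ← Finset.sum_sub_distrib]
    refine Finset.sum_congr rfl fun a _ => ?_
    rw [Finset.mul_sum, ← Finset.sum_sub_distrib]
    exact Finset.sum_congr rfl fun b _ => by ring
  -- termwise Lebowitz bound and `ab ≤ (a² + b²)/2`
  have hpt : ∀ a b, c₁ a b * (Q a b - S x y * S a b) ≤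
      (1 / 2) * (c₁ a b * S x a ^ 2 + c₁ a b * S y b ^ 2 + c₁ a b * S x b ^ 2 + c₁ a b * S y a ^ 2) := by
    intro a b
    have hcov : Q a b - S x y * S a b ≤ S x a * S y b + S x b * S y a := cov_pair_pair_le hc x y a b
    have i1 := two_mul_le_add_sq (S x a) (S y b)
    have i2 := two_mul_le_add_sq (S x b) (S y a)
    nlinarith [hc₁ a b]
  -- resummations along rows and columns
  have hA : ∀ (T : ι → ι → ℝ), (∑ a, ∑ b, c₁ a b * T x a ^ 2) ≤ R * ∑ a, χ a * T x a ^ 2 := by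
    intro T
    calc (∑ a, ∑ b, c₁ a b * T x a ^ 2) = ∑ a, T x a ^ 2 * ∑ b, c₁ a b := by
          refine Finset.sum_congr rfl fun a _ => ?_
          rw [Finset.mul_sum]
          exact Finset.sum_congr rfl fun b _ => by ring
      _ ≤ ∑ a, T x a ^ 2 * (R * χ a) :=
          Finset.sum_le_sum fun a _ => mul_le_mul_of_nonneg_left (hrow a) (sq_nonneg _)
      _ = R * ∑ a, χ a * T x a ^ 2 := by
          rw [Finset.mul_sum]
          exact Finset.sum_congr rfl fun a _ => by ring
  have hB : ∀ (T : ι → ι → ℝ), (∑ a, ∑ b, c₁ a b * T y b ^ 2) ≤ R * ∑ a, χ a * T y a ^ 2 := by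
    intro T
    rw [Finset.sum_comm]
    calc (∑ b, ∑ a, c₁ a b * T y b ^ 2) = ∑ b, T y b ^ 2 * ∑ a, c₁ a b := by
          refine Finset.sum_congr rfl fun b _ => ?_
          rw [Finset.mul_sum]
          exact Finset.sum_congr rfl fun a _ => by ring
      _ ≤ ∑ b, T y b ^ 2 * (R * χ b) :=
          Finset.sum_le_sum fun b _ => mul_le_mul_of_nonneg_left (hcol b) (sq_nonneg _)
      _ = R * ∑ a, χ a * T y a ^ 2 := by
          rw [Finset.mul_sum]
          exact Finset.sum_congr rfl fun a _ => by ring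
  have hsum : (∑ a, ∑ b, c₁ a b * (Q a b - S x y * S a b)) ≤
      (1 / 2) * ((∑ a, ∑ b, c₁ a b * S x a ^ 2) + (∑ a, ∑ b, c₁ a b * S y b ^ 2) +
        (∑ a, ∑ b, c₁ a b * S x b ^ 2) + ∑ a, ∑ b, c₁ a b * S y a ^ 2) := by
    refine (Finset.sum_le_sum fun a _ => Finset.sum_le_sum fun b _ => hpt a b).trans (le_of_eq ?_)
    simp only [Finset.mul_sum, Finset.sum_add_distrib, mul_add]
  have hxS : (∑ a, ∑ b, c₁ a b * S x a ^ 2) ≤ R * ∑ a, χ a * S x a ^ 2 := hA S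
  have hyS : (∑ a, ∑ b, c₁ a b * S y b ^ 2) ≤ R * ∑ a, χ a * S y a ^ 2 := hB S
  have hxS' : (∑ a, ∑ b, c₁ a b * S x b ^ 2) ≤ R * ∑ a, χ a * S x a ^ 2 := hB (fun _ q => S x q)
  have hyS' : (∑ a, ∑ b, c₁ a b * S y a ^ 2) ≤ R * ∑ a, χ a * S y a ^ 2 := hA (fun _ q => S y q)
  have key : (∑ a, ∑ b, c₁ a b * (Q a b - S x y * S a b)) ≤
      R * ((∑ a, χ a * S x a ^ 2) + ∑ a, χ a * S y a ^ 2) := by linarith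
  rw [hL]
  exact key

/-- Gibbs averages are continuous along any coupling family that is (pointwise) affine in the parameter. [folklore] -/
theorem continuous_gibbsAvg_of_affine (cpl : ℝ → ι → ι → ℝ) (c₀ c₁ : ι → ι → ℝ)
    (hcpl : ∀ t a b, cpl t a b = c₀ a b + t * c₁ a b) (f : SpinConfig ι → ℝ) :
    Continuous fun t : ℝ => PairIsing.gibbsAvg (cpl t) f := by
  have hfun : cpl = fun t a b => c₀ a b + t * c₁ a b := funext fun t => funext fun a => funext fun b => hcpl t a b
  subst hfun
  exact continuous_gibbsAvg_affine c₀ c₁ f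

/-- **Affine transport inequality** (Lebowitz transport + FTC): for a coupling family `cpl t = c₀ + t·c₁` with
`c₀, c₁ ≥ 0` and row/column sums of `c₁` at most `R·χ`, if on `[J₁, J₂] ⊂ [0, ∞)` the `χ`-bubbles at the base points
`x`, `y` are dominated by an integrable `B`, then `⟨σ_xσ_y⟩_{J₂} - ⟨σ_xσ_y⟩_{J₁} ≤ 2R ∫_{J₁}^{J₂} B`. [folklore] -/
theorem transport_affine (cpl : ℝ → ι → ι → ℝ) (c₀ c₁ : ι → ι → ℝ) (hcpl : ∀ t a b, cpl t a b = c₀ a b + t * c₁ a b)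
    (hc₀ : ∀ a b, 0 ≤ c₀ a b) (hc₁ : ∀ a b, 0 ≤ c₁ a b) (χ : ι → ℝ)
    {R : ℝ} (hR : 0 ≤ R) (hrow : ∀ a, ∑ b, c₁ a b ≤ R * χ a) (hcol : ∀ b, ∑ a, c₁ a b ≤ R * χ b) (x y : ι)
    {B : ℝ → ℝ} {J₁ J₂ : ℝ} (hJ₁ : 0 ≤ J₁) (h12 : J₁ ≤ J₂) (hBi : IntervalIntegrable B volume J₁ J₂)
    (hbx : ∀ t ∈ Set.Icc J₁ J₂, (∑ u, χ u * PairIsing.gibbsAvg (cpl t) (fun s => spinAt x s * spinAt u s) ^ 2) ≤ B t)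
    (hby : ∀ t ∈ Set.Icc J₁ J₂, (∑ u, χ u * PairIsing.gibbsAvg (cpl t) (fun s => spinAt y s * spinAt u s) ^ 2) ≤ B t) :
    PairIsing.gibbsAvg (cpl J₂) (fun s => spinAt x s * spinAt y s) -
        PairIsing.gibbsAvg (cpl J₁) (fun s => spinAt x s * spinAt y s) ≤ (2 * R) * ∫ t in J₁..J₂, B t := by
  have hfun : cpl = fun t a b => c₀ a b + t * c₁ a b := funext fun t => funext fun a => funext fun b => hcpl t a b
  subst hfun
  set f : SpinConfig ι → ℝ := fun s => spinAt x s * spinAt y s with hf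
  set g : ℝ → ℝ := fun t => PairIsing.gibbsAvg (fun a b => c₀ a b + t * c₁ a b) f with hg
  set g' : ℝ → ℝ := fun t =>
    PairIsing.gibbsAvg (fun a b => c₀ a b + t * c₁ a b) (fun ρ => f ρ * ∑ a, ∑ b, c₁ a b * (spinAt a ρ * spinAt b ρ)) -
      PairIsing.gibbsAvg (fun a b => c₀ a b + t * c₁ a b) f *
        PairIsing.gibbsAvg (fun a b => c₀ a b + t * c₁ a b) (fun ρ => ∑ a, ∑ b, c₁ a b * (spinAt a ρ * spinAt b ρ))
    with hg'
  have hderiv : ∀ t, HasDerivAt g (g' t) t := fun t => hasDerivAt_gibbsAvg_affine c₀ c₁ f t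
  have hg'c : Continuous g' :=
    (continuous_gibbsAvg_affine c₀ c₁ _).sub
      ((continuous_gibbsAvg_affine c₀ c₁ _).mul (continuous_gibbsAvg_affine c₀ c₁ _))
  have hbound : ∀ t ∈ Set.Icc J₁ J₂, g' t ≤ (2 * R) * B t := by
    intro t ht
    have ht0 : 0 ≤ t := hJ₁.trans ht.1
    have hct : ∀ a b, 0 ≤ c₀ a b + t * c₁ a b := fun a b => add_nonneg (hc₀ a b) (mul_nonneg ht0 (hc₁ a b))
    have hcov := cov_energy_le (c := fun a b => c₀ a b + t * c₁ a b) hct hc₁ χ R hrow hcol x y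
    have h2 : g' t ≤ R * (B t + B t) :=
      hcov.trans (mul_le_mul_of_nonneg_left (add_le_add (hbx t ht) (hby t ht)) hR)
    linarith
  have hftc : ∫ t in J₁..J₂, g' t = g J₂ - g J₁ :=
    intervalIntegral.integral_eq_sub_of_hasDerivAt (fun t _ => hderiv t) (hg'c.intervalIntegrable _ _)
  have hmono : ∫ t in J₁..J₂, g' t ≤ ∫ t in J₁..J₂, (2 * R) * B t :=
    intervalIntegral.integral_mono_on h12 (hg'c.intervalIntegrable _ _) (hBi.const_mul _) hbound
  rw [intervalIntegral.integral_const_mul, hftc] at hmono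
  exact hmono

end Affine

end PairIsing


/-- **The endpoint argument.** Let `G c L J` be box quantities (`≤ 1`, continuous in `J`) whose increments below `J`
are transported by `K ∫ B` (`B ≥ 0` locally integrable) for every `c` with `Pl c`. If every `J' ∈ [0, J)` is disordered
(no uniform positive lower bound of `sup_L G c L J'` over `{c | Pl c}`), then so is `J`: the transport, `sup_L`,
left-continuity of each `G c L` at `J`, and the continuity of the primitive of `B` at `J` would otherwise carry a positive
lower bound back to some `J₁ < J`. [folklore] -/
theorem endpoint_disorder_of_transport {C : Type*} (Pl : C → Prop) (G : C → ℕ → ℝ → ℝ) {K : ℝ} (hK : 0 ≤ K) (B : ℝ → ℝ)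
    (hB0 : ∀ t, 0 ≤ B t) (hBi : ∀ a b : ℝ, IntervalIntegrable B volume a b) {Jon : ℝ} (hJon : 0 < Jon)
    (hG1 : ∀ c L J, G c L J ≤ 1) (hGc : ∀ c L, Continuous (G c L))
    (htr : ∀ c, Pl c → ∀ (L : ℕ) (J₁ J₂ : ℝ), 0 ≤ J₁ → J₁ ≤ J₂ → J₂ < Jon →
      G c L J₂ - G c L J₁ ≤ K * ∫ t in J₁..J₂, B t)
    (hdis : ∀ J' : ℝ, 0 ≤ J' → J' < Jon → ¬ ∃ m : ℝ, 0 < m ∧ ∀ c, Pl c → m ≤ ⨆ L : ℕ, G c L J') :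
    ¬ ∃ m : ℝ, 0 < m ∧ ∀ c, Pl c → m ≤ ⨆ L : ℕ, G c L Jon := by
  rintro ⟨m, hm, hLRO⟩
  have hbdd : ∀ c J, BddAbove (Set.range fun L : ℕ => G c L J) := fun c J =>
    ⟨1, by rintro _ ⟨L, rfl⟩; exact hG1 c L J⟩
  -- transport up to the onset, box by box, through left-continuity
  have hstep : ∀ J₁ : ℝ, 0 ≤ J₁ → J₁ < Jon → ∀ c, Pl c → ∀ L : ℕ,
      G c L Jon ≤ (⨆ L : ℕ, G c L J₁) + K * ∫ t in J₁..Jon, B t := by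
    intro J₁ hJ₁ hJ₁J c hc L
    have hJ₂ : ∀ J₂ ∈ Set.Ico J₁ Jon, G c L J₂ ≤ (⨆ L : ℕ, G c L J₁) + K * ∫ t in J₁..Jon, B t := by
      rintro J₂ ⟨h12, h2J⟩
      have htr' := htr c hc L J₁ J₂ hJ₁ h12 h2J
      have hadd := intervalIntegral.integral_add_adjacent_intervals (hBi J₁ J₂) (hBi J₂ Jon)
      have hnn := intervalIntegral.integral_nonneg_of_forall (μ := volume) h2J.le hB0
      have hmono : ∫ t in J₁..J₂, B t ≤ ∫ t in J₁..Jon, B t := by linarith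
      have hle : G c L J₁ ≤ ⨆ L : ℕ, G c L J₁ := le_ciSup (hbdd c J₁) L
      have hKm := mul_le_mul_of_nonneg_left hmono hK
      linarith
    have htend : Tendsto (G c L) (𝓝[<] Jon) (𝓝 (G c L Jon)) :=
      ((hGc c L).tendsto Jon).mono_left nhdsWithin_le_nhds
    refine le_of_tendsto htend ?_
    filter_upwards [Ico_mem_nhdsLT hJ₁J] with J₂ hJ₂' using hJ₂ J₂ hJ₂'
  have hsup : ∀ J₁ : ℝ, 0 ≤ J₁ → J₁ < Jon → ∀ c, Pl c →
      (⨆ L : ℕ, G c L Jon) ≤ (⨆ L : ℕ, G c L J₁) + K * ∫ t in J₁..Jon, B t :=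
    fun J₁ hJ₁ hJ₁J c hc => ciSup_le fun L => hstep J₁ hJ₁ hJ₁J c hc L
  -- continuity of the primitive of `B` at the onset: a `J₁ < Jon` with small transport cost
  obtain ⟨J₁, hJ₁0, hJ₁J, hsmall⟩ : ∃ J₁ : ℝ, 0 ≤ J₁ ∧ J₁ < Jon ∧ K * ∫ t in J₁..Jon, B t ≤ m / 2 := by
    have hco : ContinuousOn (fun b => ∫ t in Jon..b, B t) (Set.uIcc 0 Jon) :=
      intervalIntegral.continuousOn_primitive_interval' (hBi 0 Jon) Set.right_mem_uIcc
    have hcw := hco Jon Set.right_mem_uIcc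
    rw [Metric.continuousWithinAt_iff] at hcw
    have hε : 0 < m / 2 / (K + 1) := by positivity
    obtain ⟨δ, hδ, hδε⟩ := hcw _ hε
    set J₁ : ℝ := max 0 (Jon - δ / 2) with hJ₁def
    have hJ₁J : J₁ < Jon := max_lt hJon (by linarith)
    have hmem : J₁ ∈ Set.uIcc 0 Jon := by
      rw [Set.uIcc_of_le hJon.le]
      exact ⟨le_max_left _ _, hJ₁J.le⟩
    have hdist : dist J₁ Jon < δ := by
      rw [Real.dist_eq, abs_sub_comm, abs_of_nonneg (by linarith)]
      have : Jon - δ / 2 ≤ J₁ := le_max_right _ _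
      linarith
    have h1 := hδε hmem hdist
    rw [intervalIntegral.integral_same, Real.dist_eq, sub_zero, intervalIntegral.integral_symm, abs_neg] at h1
    have hI0 : 0 ≤ ∫ t in J₁..Jon, B t := intervalIntegral.integral_nonneg_of_forall hJ₁J.le hB0
    have h2 : ∫ t in J₁..Jon, B t < m / 2 / (K + 1) := lt_of_le_of_lt (le_abs_self _) h1
    refine ⟨J₁, le_max_left _ _, hJ₁J, ?_⟩
    have h3 : K * ∫ t in J₁..Jon, B t ≤ (K + 1) * (m / 2 / (K + 1)) := by nlinarith
    have h4 : (K + 1) * (m / 2 / (K + 1)) = m / 2 := by field_simp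
    linarith
  -- order `m` at the onset would give order `m/2` at `J₁ < Jon`: contradiction with the disordered ray
  refine hdis J₁ hJ₁0 hJ₁J ⟨m / 2, by positivity, fun c hc => ?_⟩
  have h1 := hsup J₁ hJ₁0 hJ₁J c hc
  have h2 := hLRO c hc
  linarith

end Literature.Probability.LatticeModels

end
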